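import Summits.QuantumFields.YangMills.Theorems.PoincareLipschitzWeakJacobianIdentity
import Summits.QuantumFields.YangMills.Theorems.PoincareLipschitzMinimiserSecondVariation
import Literature.Analysis.FluidPDE.CKNPressureHessianSlice
import HarnessLib

/-!
# Crux `BlockLipschitzL` (stmt-QuantumFields-23533) ∕ `HistoryTailL` (stmt-QuantumFields-19936), LINE 25 «CompactnessTransfer»,
# the (TM) road, ROAD (H) «SU(2) CURRENTS ⇒ H-SYSTEM ⇒ 8π QUANTUM» — brick (Q), FILE 1 «QUATERNIONIC CURRENTS OF A UNIT `W^{1,2}` MAP `ℝ² → S³`: LETTERS, (Q1) DIVERGENCE, (Q2) ENERGY»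

Cell `ym3-torus` (YM ladder rung R3 = continuum SU(2) Yang–Mills on T³ — a RUNG, NOT Clay: not d = 4, not infinite volume,
not a mass gap); WIDTH helper seat `ym3-torus-px19` g8 (road memo `ROAD-TM-HSYSTEM-px19g8.md`, 23533 evidence); `--supports
stmt-QuantumFields-23533`; THEOREMS ONLY (0 `def`, 0 `sorry`, default heartbeats); imports this seat's ✓(Q-J)
`…PoincareLipschitzWeakJacobianIdentity` (`integral_mul_jacobian`), w7 g14's ✓`…MinimiserSecondVariation` (for its imports: w2's
(CR) chain rule, ★w3's smooth normalisation, the locality letter — the tangency pattern, here in generic dimension), Mathlib.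

THE OBSERVATION (`S³ = SU(2)`).  For a unit map `w : ℝ² → S³ ⊂ ℝ⁴ ≅ ℍ` with weak gradient, the three LEFT CURRENTS
`A_k := Im(w̄ ∂_k w)` — in coordinates, with the six sphere currents `j_{mn,k} := w_m (∂_k w)_n − w_n (∂_k w)_m`,
`A⁰ = j_{01} − j_{23}`, `A¹ = j_{02} − j_{31}`, `A² = j_{03} − j_{12}` — satisfy
(Q1) `div A^a = 0` weakly, as soon as the six sphere currents are weakly divergence-free (the conservation laws of a weakly
     harmonic sphere-valued map, w7's ✓`weaklyHarmonic`; here a HYPOTHESIS in their 2-d form);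
(Q2) `Σ_{a,k} (A^a_k)² = |∇w|²` a.e. (Euler's four-square identity + `|w| = 1` + tangency `w ⊥ ∂_k w` a.e.);
(Q3)–(Q4) (flatness = Maurer–Cartan in `D′(ℝ²)`, and the H-system rows for the planar stream functions) are FILE 2
`…PoincareLipschitzQuaternionCurrentsHSystem`; this FILE 1 holds §1 the tangency `⟪w, Gw v⟫ = 0` a.e. in generic dimension
(w7 g14's pattern), §2 the pointwise identities (Euler's four-square identity; the three Maurer–Cartan coordinate identities
`|w|²·(D_{0a} − D_{bc}) = −(A₀ × A₁)_a + ⟪w,∂₀w⟫ A^a(∂₁w) − ⟪w,∂₁w⟫ A^a(∂₀w)`, `D_{mn}` the `2 × 2` minors of `(∂₀w | ∂₁w)`, all by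
`ring`), §3 integrability∕`L²` letters, §4 (Q1), §5 (Q2).  The currents are HYPOTHESIS-PINNED functions `J`, `A` (`hJ`, `hA`) — no `def`.
HONEST SCOPE.  Sobolev∕quaternion calculus; nothing of (TM), (C), S1″, K1, `MeanDeviationL`, `BlockLipschitzL`, `HistoryTailL`
is proved here.  YM₃ on T³ is rung R3, not Clay; YM gap NOT proved; no summit statement is proved here.

References: F. Hélein (2002) [Helein2002] (§1.4 conservation laws; §3.1 weak Jacobians); H. Brezis, J.-M. Coron, Arch. Rational
Mech. Anal. 89 (1985) [BrezisCoron1985] (Appendix, Lemma A.1: the H-system); K. Uhlenbeck, J. Differential Geom. 30 (1989)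
(harmonic maps into Lie groups: `d*A = 0`, `dA + [A∧A]∕2 = 0` for `A = w⁻¹dw`) — cited for orientation only.
-/

set_option autoImplicit false

noncomputable section

open MeasureTheory Set Function Filter Topology Metric TopologicalSpace
open scoped ContDiff ENNReal BigOperators RealInnerProductSpace

namespace Summit.QuantumFields.YangMills.Theorems.PoincareLipschitzQuaternionCurrents

open Literature.Analysis.FunctionSpaces
open Summit.QuantumFields.YangMills.Theorems.PoincareLipschitzWeakJacobianIdentity (integral_mul_jacobian)
open Summit.QuantumFields.YangMills.Theorems.PoincareLipschitzSobolevChainRule (hasWeakFDerivOn_comp_of_fderiv_bounded)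
open Summit.QuantumFields.YangMills.Theorems.PoincareLipschitzSmoothNormalisation
  (contDiff_smoothNormalize exists_norm_fderiv_smoothNormalize_le smoothNormalize_eq fderiv_smoothNormalize_apply)
open Summit.QuantumFields.YangMills.Theorems.PoincareLipschitzLatticeToContinuumSobolevLetters (weakFDeriv_ae_eq_of_eqOn)

/-! ## §1 Tangency of the weak gradient of a unit map (generic dimension) -/

section Tangency

variable {E : Type*} [NormedAddCommGroup E] [InnerProductSpace ℝ E] [FiniteDimensional ℝ E]
  [MeasurableSpace E] [BorelSpace E] {μ : Measure E} [μ.IsAddHaarMeasure]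
variable {F : Type*} [NormedAddCommGroup F] [InnerProductSpace ℝ F] [CompleteSpace F]

/-- ★ **TANGENCY** (w7 g14's ✓`inner_weakGrad_eq_zero_ae` in generic dimension): for a unit Sobolev map on an open `Ω`,
`⟪U x, G x v⟫ = 0` for a.e. `x ∈ Ω` and every `v` — chain rule for the smooth normalisation `N` (`N ∘ U = U` on `Ω`,
`DN(U)h = h − ⟪U,h⟫U`) and locality∕uniqueness of weak gradients. [cite: Simon1996, §2.2] -/
theorem inner_weakGrad_eq_zero_ae {Ω : Opens E} {U : E → F} {G : E → E →L[ℝ] F}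
    (hU : HasWeakFDerivOn Ω μ U G) (hU1 : ∀ x ∈ (Ω : Set E), ‖U x‖ = 1) :
    ∀ᵐ x ∂(μ.restrict (Ω : Set E)), ∀ v : E, ⟪U x, G x v⟫ = 0 := by
  obtain ⟨C, hC⟩ := exists_norm_fderiv_smoothNormalize_le (V := F)
  have hN := hasWeakFDerivOn_comp_of_fderiv_bounded (μ := μ) hU (contDiff_smoothNormalize (V := F)) hC
  have hNU : ∀ x ∈ (Ω : Set E),
      Real.smoothTransition (‖U x‖ ^ 2 / (1 / 4) ^ 2 - 1) • (‖U x‖⁻¹ • U x) = U x := by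
    intro x hx
    rw [smoothNormalize_eq (by rw [hU1 x hx]; norm_num), hU1 x hx, inv_one, one_smul]
  have hae := weakFDeriv_ae_eq_of_eqOn hU hN le_rfl hNU
  filter_upwards [hae, ae_restrict_mem Ω.isOpen.measurableSet] with x hx hxΩ v
  have h1 : 1 / 8 < ‖U x‖ ^ 2 := by rw [hU1 x hxΩ]; norm_num
  have h2 := congrArg (fun L : E →L[ℝ] F => L v) hx
  simp only [ContinuousLinearMap.comp_apply] at h2
  rw [fderiv_smoothNormalize_apply h1, hU1 x hxΩ, one_pow, inv_one, one_smul] at h2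
  have h3 : ⟪U x, G x v⟫ • U x = 0 := by
    have : (-1 * ⟪U x, G x v⟫) • U x = 0 := by
      have h4 := h2
      rw [add_eq_left] at h4
      exact h4
    rw [neg_one_mul, neg_smul, neg_eq_zero] at this
    exact this
  have h5 : ⟪U x, G x v⟫ * ‖U x‖ ^ 2 = 0 := by
    have := congrArg (fun z => ⟪z, U x⟫) h3
    simp only [real_inner_smul_left, inner_zero_left, real_inner_self_eq_norm_sq] at this
    exact this
  rw [hU1 x hxΩ, one_pow, mul_one] at h5
  exact h5

end Tangency

/-! ## §2 Pointwise quaternion algebra (Euler's four-square identity; Maurer–Cartan) -/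

/-- **Euler's four-square identity, current form**: with `jₘₙ = wₘ dₙ − wₙ dₘ`,
`(j₀₁ − j₂₃)² + (j₀₂ − j₃₁)² + (j₀₃ − j₁₂)² + (Σ wₘdₘ)² = (Σ wₘ²)(Σ dₘ²)` — i.e. `|Im(w̄d)|² + Re(w̄d)² = |w|²|d|²`. [folklore] -/
theorem four_square_currents (w0 w1 w2 w3 d0 d1 d2 d3 : ℝ) :
    ((w0 * d1 - w1 * d0) - (w2 * d3 - w3 * d2)) ^ 2 + ((w0 * d2 - w2 * d0) - (w3 * d1 - w1 * d3)) ^ 2 +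
        ((w0 * d3 - w3 * d0) - (w1 * d2 - w2 * d1)) ^ 2 + (w0 * d0 + w1 * d1 + w2 * d2 + w3 * d3) ^ 2 =
      (w0 ^ 2 + w1 ^ 2 + w2 ^ 2 + w3 ^ 2) * (d0 ^ 2 + d1 ^ 2 + d2 ^ 2 + d3 ^ 2) := by
  ring

/-- **Maurer–Cartan, pointwise (coordinate `i`)**: with `A^a(d)` the left currents built on `d` and `Dₘₙ = dₘ eₙ − dₙ eₘ` the
`2 × 2` minors of `(d | e)`: `|w|²·(D₀₁ − D₂₃) = −(A¹(d)A²(e) − A²(d)A¹(e)) + ⟪w,d⟫·A⁰(e) − ⟪w,e⟫·A⁰(d)`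
(`Im(d̄e)·|w|² = Im((w̄d)‾(w̄e))`). [folklore] -/
theorem maurerCartan_pointwise_0 (w0 w1 w2 w3 d0 d1 d2 d3 e0 e1 e2 e3 : ℝ) :
    (w0 ^ 2 + w1 ^ 2 + w2 ^ 2 + w3 ^ 2) * ((d0 * e1 - d1 * e0) - (d2 * e3 - d3 * e2)) =
      -(((w0 * d2 - w2 * d0) - (w3 * d1 - w1 * d3)) * ((w0 * e3 - w3 * e0) - (w1 * e2 - w2 * e1)) -
          ((w0 * d3 - w3 * d0) - (w1 * d2 - w2 * d1)) * ((w0 * e2 - w2 * e0) - (w3 * e1 - w1 * e3))) +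
        (w0 * d0 + w1 * d1 + w2 * d2 + w3 * d3) * ((w0 * e1 - w1 * e0) - (w2 * e3 - w3 * e2)) -
        (w0 * e0 + w1 * e1 + w2 * e2 + w3 * e3) * ((w0 * d1 - w1 * d0) - (w2 * d3 - w3 * d2)) := by
  ring

/-- Maurer–Cartan, pointwise, coordinate `j`: `|w|²·(D₀₂ − D₃₁) = −(A²(d)A⁰(e) − A⁰(d)A²(e)) + ⟪w,d⟫A¹(e) − ⟪w,e⟫A¹(d)`. [folklore] -/
theorem maurerCartan_pointwise_1 (w0 w1 w2 w3 d0 d1 d2 d3 e0 e1 e2 e3 : ℝ) :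
    (w0 ^ 2 + w1 ^ 2 + w2 ^ 2 + w3 ^ 2) * ((d0 * e2 - d2 * e0) - (d3 * e1 - d1 * e3)) =
      -(((w0 * d3 - w3 * d0) - (w1 * d2 - w2 * d1)) * ((w0 * e1 - w1 * e0) - (w2 * e3 - w3 * e2)) -
          ((w0 * d1 - w1 * d0) - (w2 * d3 - w3 * d2)) * ((w0 * e3 - w3 * e0) - (w1 * e2 - w2 * e1))) +
        (w0 * d0 + w1 * d1 + w2 * d2 + w3 * d3) * ((w0 * e2 - w2 * e0) - (w3 * e1 - w1 * e3)) -
        (w0 * e0 + w1 * e1 + w2 * e2 + w3 * e3) * ((w0 * d2 - w2 * d0) - (w3 * d1 - w1 * d3)) := by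
  ring

/-- Maurer–Cartan, pointwise, coordinate `k`: `|w|²·(D₀₃ − D₁₂) = −(A⁰(d)A¹(e) − A¹(d)A⁰(e)) + ⟪w,d⟫A²(e) − ⟪w,e⟫A²(d)`. [folklore] -/
theorem maurerCartan_pointwise_2 (w0 w1 w2 w3 d0 d1 d2 d3 e0 e1 e2 e3 : ℝ) :
    (w0 ^ 2 + w1 ^ 2 + w2 ^ 2 + w3 ^ 2) * ((d0 * e3 - d3 * e0) - (d1 * e2 - d2 * e1)) =
      -(((w0 * d1 - w1 * d0) - (w2 * d3 - w3 * d2)) * ((w0 * e2 - w2 * e0) - (w3 * e1 - w1 * e3)) -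
          ((w0 * d2 - w2 * d0) - (w3 * d1 - w1 * d3)) * ((w0 * e1 - w1 * e0) - (w2 * e3 - w3 * e2))) +
        (w0 * d0 + w1 * d1 + w2 * d2 + w3 * d3) * ((w0 * e3 - w3 * e0) - (w1 * e2 - w2 * e1)) -
        (w0 * e0 + w1 * e1 + w2 * e2 + w3 * e3) * ((w0 * d3 - w3 * d0) - (w1 * d2 - w2 * d1)) := by
  ring

/-! ## §3 Letters on `ℝ²`: coordinates, integrability, `L²` -/

section Plane

open Summit.QuantumFields.YangMills.Theorems.PoincareLipschitzWeakChainRuleShear (integrableOn_smul_of_locallyIntegrableOn)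
open Summit.QuantumFields.YangMills.Theorems.PoincareLipschitzWeakJacobianIdentity (integrable_mul_of_L2)

/-- `‖v‖² = Σᵢ vᵢ²` on `ℝ⁴`. [folklore] -/
theorem norm_sq_eq_sum_four (v : EuclideanSpace ℝ (Fin 4)) : ‖v‖ ^ 2 = v 0 ^ 2 + v 1 ^ 2 + v 2 ^ 2 + v 3 ^ 2 := by
  rw [EuclideanSpace.norm_eq, Real.sq_sqrt (Finset.sum_nonneg fun i _ => by positivity)]
  simp [Fin.sum_univ_four, Real.norm_eq_abs, sq_abs]

/-- `⟪w, d⟫ = Σᵢ wᵢ dᵢ` on `ℝ⁴`. [folklore] -/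
theorem inner_eq_sum_four (w d : EuclideanSpace ℝ (Fin 4)) : ⟪w, d⟫ = w 0 * d 0 + w 1 * d 1 + w 2 * d 2 + w 3 * d 3 := by
  simp [PiLp.inner_apply, Fin.sum_univ_four, mul_comm]

/-- The operator norm on `ℝ²` is at most the sum of the norms of the images of the two coordinate vectors. [folklore] -/
theorem opNorm_le_sum_two {F' : Type*} [NormedAddCommGroup F'] [NormedSpace ℝ F']
    (T : EuclideanSpace ℝ (Fin 2) →L[ℝ] F') :
    ‖T‖ ≤ ∑ k : Fin 2, ‖T (EuclideanSpace.single k (1:ℝ))‖ := by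
  refine ContinuousLinearMap.opNorm_le_bound _ (Finset.sum_nonneg fun i _ => norm_nonneg _) fun v => ?_
  have hv : T v = ∑ i : Fin 2, v i • T (EuclideanSpace.single i (1:ℝ)) := by
    conv_lhs => rw [← (EuclideanSpace.basisFun (Fin 2) ℝ).sum_repr v]
    rw [map_sum]
    refine Finset.sum_congr rfl fun i _ => ?_
    rw [map_smul, EuclideanSpace.basisFun_repr, EuclideanSpace.basisFun_apply]
  have hvi : ∀ i : Fin 2, |v i| ≤ ‖v‖ := fun i => by
    rw [EuclideanSpace.norm_eq]
    refine Real.le_sqrt_of_sq_le ?_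
    have : |v i| ^ 2 = ‖v i‖ ^ 2 := by rw [Real.norm_eq_abs]
    rw [this]
    exact Finset.single_le_sum (f := fun j => ‖v j‖ ^ 2) (fun j _ => sq_nonneg _) (Finset.mem_univ i)
  rw [hv, Finset.sum_mul]
  refine (norm_sum_le _ _).trans (Finset.sum_le_sum fun i _ => ?_)
  rw [norm_smul, Real.norm_eq_abs, mul_comm]
  exact mul_le_mul_of_nonneg_left (hvi i) (norm_nonneg _)

variable {w : EuclideanSpace ℝ (Fin 2) → EuclideanSpace ℝ (Fin 4)}
  {Gw : EuclideanSpace ℝ (Fin 2) → EuclideanSpace ℝ (Fin 2) →L[ℝ] EuclideanSpace ℝ (Fin 4)}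

/-- The coordinate functions of a Sobolev map are Sobolev, with the coordinate rows of the weak gradient. [folklore] -/
theorem hasWeakFDerivOn_coord (hw : HasWeakFDerivOn ⟨Set.univ, isOpen_univ⟩ volume w Gw) (m : Fin 4) :
    HasWeakFDerivOn (⟨Set.univ, isOpen_univ⟩ : Opens (EuclideanSpace ℝ (Fin 2))) volume (fun y => w y m)
      (fun y => (EuclideanSpace.proj m).comp (Gw y)) := by
  have := hw.clm_comp (EuclideanSpace.proj m)
  simpa using this

/-- Measurability of `w` on the plane. [folklore] -/
theorem aestronglyMeasurable_of_sobolev (hw : HasWeakFDerivOn ⟨Set.univ, isOpen_univ⟩ volume w Gw) :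
    AEStronglyMeasurable w volume := by
  have := hw.locallyIntegrableOn.aestronglyMeasurable
  simpa only [TopologicalSpace.Opens.coe_mk, Measure.restrict_univ] using this

/-- Measurability of the weak gradient on the plane. [folklore] -/
theorem aestronglyMeasurable_grad (hw : HasWeakFDerivOn ⟨Set.univ, isOpen_univ⟩ volume w Gw) :
    AEStronglyMeasurable Gw volume := by
  have := hw.locallyIntegrableOn_deriv.aestronglyMeasurable
  simpa only [TopologicalSpace.Opens.coe_mk, Measure.restrict_univ] using this

/-- Each column `Gw e_k` of a finite-energy weak gradient is in `L²`. [folklore] -/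
theorem memLp_grad_apply (hw : HasWeakFDerivOn ⟨Set.univ, isOpen_univ⟩ volume w Gw)
    (hE : Integrable (fun y => ∑ k : Fin 2, ‖Gw y (EuclideanSpace.single k (1:ℝ))‖ ^ 2) volume) (k : Fin 2) :
    MemLp (fun y => Gw y (EuclideanSpace.single k (1:ℝ))) 2 volume := by
  have hm : AEStronglyMeasurable (fun y => Gw y (EuclideanSpace.single k (1:ℝ))) volume :=
    (ContinuousLinearMap.apply ℝ (EuclideanSpace ℝ (Fin 4)) (EuclideanSpace.single k (1:ℝ))).continuous
      |>.comp_aestronglyMeasurable (aestronglyMeasurable_grad hw)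
  refine (memLp_two_iff_integrable_sq_norm hm).2 ?_
  refine hE.mono (hm.norm.pow 2) (Filter.Eventually.of_forall fun y => ?_)
  rw [Real.norm_eq_abs, Real.norm_eq_abs, abs_of_nonneg (by positivity),
    abs_of_nonneg (Finset.sum_nonneg fun i _ => by positivity)]
  exact Finset.single_le_sum (f := fun i => ‖Gw y (EuclideanSpace.single i (1:ℝ))‖ ^ 2)
    (fun i _ => by positivity) (Finset.mem_univ k)

/-- Each entry `(Gw e_k)_m` is in `L²`. [folklore] -/
theorem memLp_grad_coord (hw : HasWeakFDerivOn ⟨Set.univ, isOpen_univ⟩ volume w Gw)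
    (hE : Integrable (fun y => ∑ k : Fin 2, ‖Gw y (EuclideanSpace.single k (1:ℝ))‖ ^ 2) volume) (k : Fin 2) (m : Fin 4) :
    MemLp (fun y => Gw y (EuclideanSpace.single k (1:ℝ)) m) 2 volume := by
  have := (EuclideanSpace.proj m : EuclideanSpace ℝ (Fin 4) →L[ℝ] ℝ).comp_memLp' (memLp_grad_apply hw hE k)
  simpa [Function.comp_def] using this

/-- `∂_kη · (Gw e_k)_n` is integrable for a smooth compactly supported `η`. [folklore] -/
theorem integrable_fderiv_mul_grad_coord (hw : HasWeakFDerivOn ⟨Set.univ, isOpen_univ⟩ volume w Gw)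
    {η : EuclideanSpace ℝ (Fin 2) → ℝ} (hη : ContDiff ℝ ∞ η) (hηc : HasCompactSupport η) (k l : Fin 2) (n : Fin 4) :
    Integrable (fun y => fderiv ℝ η y (EuclideanSpace.single l (1:ℝ)) * Gw y (EuclideanSpace.single k (1:ℝ)) n) volume := by
  have hc : Continuous fun y => fderiv ℝ η y (EuclideanSpace.single l (1:ℝ)) :=
    (hη.continuous_fderiv (by simp)).clm_apply continuous_const
  have h := integrableOn_smul_of_locallyIntegrableOn hw.locallyIntegrableOn_deriv hc
    (hηc.fderiv_apply (𝕜 := ℝ) (EuclideanSpace.single l (1:ℝ))) (Set.subset_univ _)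
  simp only [TopologicalSpace.Opens.coe_mk, integrableOn_univ] at h
  have := ((EuclideanSpace.proj n : EuclideanSpace ℝ (Fin 4) →L[ℝ] ℝ).comp
    (ContinuousLinearMap.apply ℝ (EuclideanSpace ℝ (Fin 4)) (EuclideanSpace.single k (1:ℝ)))).integrable_comp h
  simpa [Function.comp_def] using this

/-- `∂_lη · (w_m (Gw e_k)_n)` is integrable. [folklore] -/
theorem integrable_fderiv_mul_coord_mul_grad (hw : HasWeakFDerivOn ⟨Set.univ, isOpen_univ⟩ volume w Gw)
    (hw1 : ∀ y, ‖w y‖ = 1) {η : EuclideanSpace ℝ (Fin 2) → ℝ} (hη : ContDiff ℝ ∞ η) (hηc : HasCompactSupport η)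
    (k l : Fin 2) (m n : Fin 4) :
    Integrable (fun y => fderiv ℝ η y (EuclideanSpace.single l (1:ℝ)) *
      (w y m * Gw y (EuclideanSpace.single k (1:ℝ)) n)) volume := by
  have h := (integrable_fderiv_mul_grad_coord hw hη hηc k l n).bdd_mul (c := 1)
    ((EuclideanSpace.proj m : EuclideanSpace ℝ (Fin 4) →L[ℝ] ℝ).continuous.comp_aestronglyMeasurable
      (aestronglyMeasurable_of_sobolev hw))
    (Filter.Eventually.of_forall fun y => by
      simpa [hw1 y] using PiLp.norm_apply_le (w y) m)
  refine h.congr (Filter.Eventually.of_forall fun y => ?_)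
  simp only [PiLp.proj_apply]
  ring

/-- `η · (Gw e₀)_m · (Gw e₁)_n` is integrable (bounded × `L²` × `L²`). [folklore] -/
theorem integrable_mul_grad_grad (hw : HasWeakFDerivOn ⟨Set.univ, isOpen_univ⟩ volume w Gw)
    (hE : Integrable (fun y => ∑ k : Fin 2, ‖Gw y (EuclideanSpace.single k (1:ℝ))‖ ^ 2) volume)
    {η : EuclideanSpace ℝ (Fin 2) → ℝ} (hη : ContDiff ℝ ∞ η) (hηc : HasCompactSupport η) (k l : Fin 2) (m n : Fin 4) :
    Integrable (fun y => η y * (Gw y (EuclideanSpace.single k (1:ℝ)) m * Gw y (EuclideanSpace.single l (1:ℝ)) n)) volume := by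
  obtain ⟨M, hM⟩ := hηc.exists_bound_of_continuous hη.continuous
  exact (integrable_mul_of_L2 (memLp_grad_coord hw hE k m) (memLp_grad_coord hw hE l n)).bdd_mul
    hη.continuous.aestronglyMeasurable (Filter.Eventually.of_forall hM)

/-! ## §4 The six sphere currents and the three left currents: divergence-free -/

/-- **The sphere currents are weakly divergence-free** when the conservation laws hold for all orthonormal pairs (instance
`p = e_m`, `q = e_n`): `∫ Σ_k ∂_kη (w_m (∂_k w)_n − w_n (∂_k w)_m) = 0`. [cite: Helein2002, §1.4 (conservation laws of sphere-valued harmonic maps)] -/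
theorem sphereCurrent_divFree
    (hcl : ∀ (p q : EuclideanSpace ℝ (Fin 4)), ‖p‖ = 1 → ‖q‖ = 1 → ⟪p, q⟫ = 0 →
      ∀ η : EuclideanSpace ℝ (Fin 2) → ℝ, ContDiff ℝ ∞ η → HasCompactSupport η →
        ∫ y, ∑ k : Fin 2, fderiv ℝ η y (EuclideanSpace.single k (1:ℝ)) *
          (⟪p, w y⟫ * ⟪Gw y (EuclideanSpace.single k (1:ℝ)), q⟫ - ⟪q, w y⟫ * ⟪Gw y (EuclideanSpace.single k (1:ℝ)), p⟫) = 0)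
    {J : Fin 4 → Fin 4 → EuclideanSpace ℝ (Fin 2) → Fin 2 → ℝ}
    (hJ : ∀ m n y k, J m n y k = w y m * Gw y (EuclideanSpace.single k (1:ℝ)) n - w y n * Gw y (EuclideanSpace.single k (1:ℝ)) m)
    {m n : Fin 4} (hmn : m ≠ n) {η : EuclideanSpace ℝ (Fin 2) → ℝ} (hη : ContDiff ℝ ∞ η) (hηc : HasCompactSupport η) :
    ∫ y, ∑ k : Fin 2, fderiv ℝ η y (EuclideanSpace.single k (1:ℝ)) * J m n y k = 0 := by
  have h := hcl (EuclideanSpace.single m (1:ℝ)) (EuclideanSpace.single n (1:ℝ)) (by simp) (by simp)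
    (by simp [EuclideanSpace.inner_single_left, hmn.symm]) η hη hηc
  refine Eq.trans (integral_congr_ae (Filter.Eventually.of_forall fun y => ?_)) h
  refine Finset.sum_congr rfl fun k _ => ?_
  simp only [hJ, EuclideanSpace.inner_single_left, EuclideanSpace.inner_single_right, map_one, one_mul, conj_trivial]

/-- ★ **(Q1) THE THREE LEFT CURRENTS ARE WEAKLY DIVERGENCE-FREE**: `A⁰ = j₀₁ − j₂₃`, `A¹ = j₀₂ − j₃₁`, `A² = j₀₃ − j₁₂`
(the coordinates of `Im(w̄ ∂w)`), each tested against `∇η` integrates to zero. [cite: Helein2002, §1.4] -/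
theorem leftCurrents_divFree (hw : HasWeakFDerivOn ⟨Set.univ, isOpen_univ⟩ volume w Gw) (hw1 : ∀ y, ‖w y‖ = 1)
    (hcl : ∀ (p q : EuclideanSpace ℝ (Fin 4)), ‖p‖ = 1 → ‖q‖ = 1 → ⟪p, q⟫ = 0 →
      ∀ η : EuclideanSpace ℝ (Fin 2) → ℝ, ContDiff ℝ ∞ η → HasCompactSupport η →
        ∫ y, ∑ k : Fin 2, fderiv ℝ η y (EuclideanSpace.single k (1:ℝ)) *
          (⟪p, w y⟫ * ⟪Gw y (EuclideanSpace.single k (1:ℝ)), q⟫ - ⟪q, w y⟫ * ⟪Gw y (EuclideanSpace.single k (1:ℝ)), p⟫) = 0)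
    {J : Fin 4 → Fin 4 → EuclideanSpace ℝ (Fin 2) → Fin 2 → ℝ}
    (hJ : ∀ m n y k, J m n y k = w y m * Gw y (EuclideanSpace.single k (1:ℝ)) n - w y n * Gw y (EuclideanSpace.single k (1:ℝ)) m)
    {A : Fin 3 → EuclideanSpace ℝ (Fin 2) → Fin 2 → ℝ}
    (hA : ∀ y k, A 0 y k = J 0 1 y k - J 2 3 y k ∧ A 1 y k = J 0 2 y k - J 3 1 y k ∧ A 2 y k = J 0 3 y k - J 1 2 y k)
    (a : Fin 3) {η : EuclideanSpace ℝ (Fin 2) → ℝ} (hη : ContDiff ℝ ∞ η) (hηc : HasCompactSupport η) :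
    ∫ y, ∑ k : Fin 2, fderiv ℝ η y (EuclideanSpace.single k (1:ℝ)) * A a y k = 0 := by
  -- integrability of each `Σ_k ∂_kη J_{mn,k}`
  have hint : ∀ m n : Fin 4, Integrable (fun y => ∑ k : Fin 2, fderiv ℝ η y (EuclideanSpace.single k (1:ℝ)) * J m n y k) volume := by
    intro m n
    refine integrable_finsetSum _ fun k _ => ?_
    have h := (integrable_fderiv_mul_coord_mul_grad hw hw1 hη hηc k k m n).sub
      (integrable_fderiv_mul_coord_mul_grad hw hw1 hη hηc k k n m)
    refine h.congr (Filter.Eventually.of_forall fun y => ?_)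
    simp only [hJ, Pi.sub_apply]
    ring
  have hdiv := fun (m n : Fin 4) (h : m ≠ n) => sphereCurrent_divFree hcl hJ h hη hηc
  have key : ∀ m n m' n' : Fin 4, m ≠ n → m' ≠ n' →
      ∫ y, ∑ k : Fin 2, fderiv ℝ η y (EuclideanSpace.single k (1:ℝ)) * (J m n y k - J m' n' y k) = 0 := by
    intro m n m' n' h h'
    have : (fun y => ∑ k : Fin 2, fderiv ℝ η y (EuclideanSpace.single k (1:ℝ)) * (J m n y k - J m' n' y k)) =
        fun y => (∑ k : Fin 2, fderiv ℝ η y (EuclideanSpace.single k (1:ℝ)) * J m n y k) -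
          ∑ k : Fin 2, fderiv ℝ η y (EuclideanSpace.single k (1:ℝ)) * J m' n' y k := by
      funext y
      rw [← Finset.sum_sub_distrib]
      refine Finset.sum_congr rfl fun k _ => by ring
    rw [this, integral_sub (hint m n) (hint m' n'), hdiv m n h, hdiv m' n' h', sub_zero]
  fin_cases a
  · simp only [Fin.zero_eta, (hA _ _).1]
    exact key 0 1 2 3 (by decide) (by decide)
  · simp only [Fin.mk_one, (hA _ _).2.1]
    exact key 0 2 3 1 (by decide) (by decide)
  · simp only [Fin.reduceFinMk, (hA _ _).2.2]
    exact key 0 3 1 2 (by decide) (by decide)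

/-! ## §5 (Q2) The energy identity `Σ_{a,k} (A^a_k)² = |∇w|²` a.e. -/

/-- ★ **(Q2) ENERGY OF THE LEFT CURRENTS**: `Σₐ Σ_k (A^a_k)² = Σ_k ‖Gw e_k‖²` a.e. — Euler's four-square identity with `|w| = 1`
and the a.e. tangency `⟪w, Gw e_k⟫ = 0` (`|Im(w̄ ∂_k w)|² = |∂_k w|²`). [folklore] -/
theorem leftCurrents_energy_ae (hw : HasWeakFDerivOn ⟨Set.univ, isOpen_univ⟩ volume w Gw) (hw1 : ∀ y, ‖w y‖ = 1)
    {J : Fin 4 → Fin 4 → EuclideanSpace ℝ (Fin 2) → Fin 2 → ℝ}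
    (hJ : ∀ m n y k, J m n y k = w y m * Gw y (EuclideanSpace.single k (1:ℝ)) n - w y n * Gw y (EuclideanSpace.single k (1:ℝ)) m)
    {A : Fin 3 → EuclideanSpace ℝ (Fin 2) → Fin 2 → ℝ}
    (hA : ∀ y k, A 0 y k = J 0 1 y k - J 2 3 y k ∧ A 1 y k = J 0 2 y k - J 3 1 y k ∧ A 2 y k = J 0 3 y k - J 1 2 y k) :
    ∀ᵐ y, ∑ a : Fin 3, ∑ k : Fin 2, A a y k ^ 2 = ∑ k : Fin 2, ‖Gw y (EuclideanSpace.single k (1:ℝ))‖ ^ 2 := by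
  have htan := inner_weakGrad_eq_zero_ae hw (fun y _ => hw1 y)
  simp only [TopologicalSpace.Opens.coe_mk, Measure.restrict_univ] at htan
  filter_upwards [htan] with y hy
  have hunit := norm_sq_eq_sum_four (w y)
  rw [hw1 y, one_pow] at hunit
  have key : ∀ k : Fin 2, A 0 y k ^ 2 + A 1 y k ^ 2 + A 2 y k ^ 2 = ‖Gw y (EuclideanSpace.single k (1:ℝ))‖ ^ 2 := by
    intro k
    have ht := hy (EuclideanSpace.single k (1:ℝ))
    rw [inner_eq_sum_four] at ht
    have h4 := four_square_currents (w y 0) (w y 1) (w y 2) (w y 3)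
      (Gw y (EuclideanSpace.single k (1:ℝ)) 0) (Gw y (EuclideanSpace.single k (1:ℝ)) 1)
      (Gw y (EuclideanSpace.single k (1:ℝ)) 2) (Gw y (EuclideanSpace.single k (1:ℝ)) 3)
    rw [(hA y k).1, (hA y k).2.1, (hA y k).2.2, hJ, hJ, hJ, hJ, hJ, hJ, norm_sq_eq_sum_four]
    linear_combination h4 -
      (Gw y (EuclideanSpace.single k (1:ℝ)) 0 ^ 2 + Gw y (EuclideanSpace.single k (1:ℝ)) 1 ^ 2 +
        Gw y (EuclideanSpace.single k (1:ℝ)) 2 ^ 2 + Gw y (EuclideanSpace.single k (1:ℝ)) 3 ^ 2) * hunit -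
      (w y 0 * Gw y (EuclideanSpace.single k (1:ℝ)) 0 + w y 1 * Gw y (EuclideanSpace.single k (1:ℝ)) 1 +
        w y 2 * Gw y (EuclideanSpace.single k (1:ℝ)) 2 + w y 3 * Gw y (EuclideanSpace.single k (1:ℝ)) 3) * ht
  simp only [Fin.sum_univ_three, Fin.sum_univ_two]
  linear_combination key 0 + key 1


end Plane

end Summit.QuantumFields.YangMills.Theorems.PoincareLipschitzQuaternionCurrents
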